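import Summits.CriticalPhenomena.PercolationContinuityZ3.Theorems.PercNearOneGluingNearOneGluingS2OfS2M
import Summits.CriticalPhenomena.PercolationContinuityZ3.Theorems.PercNearOneGluingNearOneGluingU1M

/-!
# Crux `PercNearOneGluing.NearOneGluing` (stmt-CriticalPhenomena-4574), line `SketchR2I5` —
# provable pieces of the sharp exchange slack S2_M (stub `stub_s2M`): cross term, T1, coincidence cases

Lead prover-line-stmt-CriticalPhenomena-4574-c7 (cycle 7, wave 4, stub-worker W6).  Lands
`--supports stmt-CriticalPhenomena-4574`; no definitions, no named facts.

## Content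

Finite weighted graph on `Fin n`, `μ = prodBernoulli w`, `{u ↔ v} = openConn u v`; `x, y, z` pairwise distinct, `o, b`
arbitrary.  Notation: `D := {y ↮ z}`, `M := {x ↮ z} ∩ {y ↮ z}`, `M′ := {x ↔ z} ∩ {y ↮ z}` (so `D = M ⊔ M′`),
`D″ := {y ↮ x} ∩ {y ↮ z}`, `N := {x ↮ y} ∩ {x ↮ z} ∩ {y ↮ z}`, `J := {o↔x} ∪ {o↔y}`, `J̃ := {o↔y} ∪ ({o↔x} ∩ {x ↮ z})`,
`θ_M := μ({o↔x} ∩ N)/μ(N)`, `ψ := 1{o↔y} − θ_M·1{x↔y}`, and for an event `Q`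
`τ_b(Q) := μ(D)·μ(Q ∩ {z↮b} ∩ D) − μ(Q ∩ D)·μ({z↮b} ∩ D)` (`= μ(D)²·Cov_D(1_Q, 1{z↮b})`).
The registered sharp residual `stub_s2M` of the line reads `μ({o↔x} ∩ N)·τ_b({x↔y}) ≤ μ(N)·τ_b({o↔y})`
(`Cov_D(ψ, 1{z↮b}) ≥ 0`; 0 violations in all exact checks, OPEN).  This file proves the following PIECES of it.

1. `s2Mp_cross` — the **cross term** of the cell decomposition `D = M ⊔ M′` is nonnegative:
   `μ(N)·μ(M)·μ({o↔y} ∩ M′) ≤ μ(M′)·[μ(N)·μ({o↔y} ∩ M) − μ({o↔x} ∩ N)·μ({x↔y} ∩ D)]`,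
   i.e. `E[ψ | M] ≥ E[ψ | M′] = P(o↔y | M′)`.  Proof: Harris given `M` for `J` and `{x↔y}` (`u1M_harrisM`, BHK Thm 1.3
   for the source set `{x,y}`) gives `μ(N)·μ(o↔y,x↔y,D) ≥ (μ(o↔x,N) + μ(o↔y,N))·μ(x↔y,D)`, and BHK Thm 1.4 for `C_y`
   versus `C_{{x,z}}` given `D″` (`u1M_bhk14`) gives the tilt `μ(o↔y,N)·μ(M′) ≥ μ(N)·μ(o↔y,M′)`; the claim is
   `μ(M′) × (first) + (μ(x↔y,D) + μ(N)) × (second)`.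
2. `s2Mp_case_bx` — **`stub_s2M` in the coincidence case `b = x`**: there `{z↮b} ∩ D = M` and the registered
   inequality is literally the cross-term inequality of item 1.
3. `s2Mp_t1M` — **T1 at the sharp constant**: `μ({o↔x} ∩ N)·μ({x↔y} ∩ D) ≤ μ(N)·μ({o↔y} ∩ D)`
   (`P_D(o↔y) ≥ θ_M·P_D(x↔y)`), from U1-M (`u1M`); and `s2Mp_case_bo` — **`stub_s2M` in the coincidence case `b = o`**,
   where `τ_o({o↔y}) = μ({o↔z} ∩ D)·μ({o↔y} ∩ D)` and `τ_o({x↔y}) = μ({o↔z} ∩ D)μ({x↔y} ∩ D) − μ(D)μ({x↔y} ∩ {o↔z} ∩ D)`.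
The companion file `…S2MLemmaM` proves Lemma M, `Cov_D(1_J̃, 1{z↮b}) ≥ 0` (the Harris part of the exchange
decomposition of S2_M).  What is NOT proved (the genuine residual of `stub_s2M`, worker report S2M.md): the
"unblocking debt" `Cov_D(1_J̃ + θ_M·1{x↔z}, 1{z↮b}) ≥ P_D(N)·Cov_N(1{o↔x}, 1{z↮b})`.
[cite: VandenbergHaggstromKahn2005, Thm. 1.3 (p. 6), Thm. 1.4 (p. 7)] [cite: KozmaNitzan2024, Question 7 (p. 36), Lemma 2 (p. 6)]
-/

namespace Summit.CriticalPhenomena.PercolationContinuityZ3.Theorems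

open MeasureTheory Set Literature.Probability.LatticeModels Literature.Probability.Percolation
open scoped Classical BigOperators
open Q7ThreeCut

noncomputable section

variable {n : ℕ}

/-! ### §1. The cross term of the `M ⊔ M′` decomposition -/

/-- **Cross term.**  With `M = {x↮z} ∩ {y↮z}`, `M′ = {x↔z} ∩ {y↮z}`, `N = {x↮y} ∩ {x↮z} ∩ {y↮z}`:
`μ(N)·μ(M)·μ({o↔y} ∩ M′) ≤ μ(M′)·(μ(N)·μ({o↔y} ∩ M) − μ({o↔x} ∩ N)·μ({x↔y} ∩ {y↮z}))`, i.e.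
`P(o↔y | M) − θ_M·P(x↔y | M) ≥ P(o↔y | M′)`.  From `u1M_harrisM` (BHK Thm 1.3 for the source set `{x,y}` given `M`)
and `u1M_bhk14` (BHK Thm 1.4 for `C_y` versus `C_{{x,z}}` given `{y↮x} ∩ {y↮z}`).
[cite: VandenbergHaggstromKahn2005, Thm. 1.3 (p. 6), Thm. 1.4 (p. 7)] -/
theorem s2Mp_cross (w : Sym2 (Fin n) → unitInterval) (o x y z : Fin n) (hxy : x ≠ y) (hxz : x ≠ z) (hyz : y ≠ z) :
    (prodBernoulli w).real ((openConn x y)ᶜ ∩ (openConn x z)ᶜ ∩ (openConn y z)ᶜ) *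
        (prodBernoulli w).real ((openConn x z)ᶜ ∩ (openConn y z)ᶜ) *
          (prodBernoulli w).real (openConn o y ∩ (openConn x z ∩ (openConn y z)ᶜ)) ≤
      (prodBernoulli w).real (openConn x z ∩ (openConn y z)ᶜ) *
        ((prodBernoulli w).real ((openConn x y)ᶜ ∩ (openConn x z)ᶜ ∩ (openConn y z)ᶜ) *
            (prodBernoulli w).real (openConn o y ∩ ((openConn x z)ᶜ ∩ (openConn y z)ᶜ)) -
          (prodBernoulli w).real (openConn o x ∩ ((openConn x y)ᶜ ∩ (openConn x z)ᶜ ∩ (openConn y z)ᶜ)) *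
            (prodBernoulli w).real (openConn x y ∩ (openConn y z)ᶜ)) := by
  have hH := u1M_harrisM w o x y z hxz hyz
  have hB := u1M_bhk14 w o x y z hxy hyz
  set μ := prodBernoulli w with hμ
  set N : Set (BondConfig (Fin n)) := (openConn x y)ᶜ ∩ (openConn x z)ᶜ ∩ (openConn y z)ᶜ with hN
  set D2 : Set (BondConfig (Fin n)) := (openConn y x)ᶜ ∩ (openConn y z)ᶜ with hD2
  set M : Set (BondConfig (Fin n)) := (openConn x z)ᶜ ∩ (openConn y z)ᶜ with hM
  set Mp : Set (BondConfig (Fin n)) := openConn x z ∩ (openConn y z)ᶜ with hMp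
  have hmeas : ∀ s : Set (BondConfig (Fin n)), MeasurableSet s := fun _ => MeasurableSet.of_discrete
  -- set identities around `M` (as in `u1M`)
  have s1 : M ∩ openConn x y = openConn x y ∩ (openConn y z)ᶜ := by
    ext ω
    simp only [hM, mem_inter_iff, mem_compl_iff]
    constructor
    · rintro ⟨⟨-, hyz'⟩, hxy'⟩
      exact ⟨hxy', hyz'⟩
    · rintro ⟨hxy', hyz'⟩
      exact ⟨⟨fun hxz' => hyz' (conn_trans (conn_symm hxy') hxz'), hyz'⟩, hxy'⟩
  have s2 : M ∩ ((openConn o x ∪ openConn o y) ∩ openConn x y) =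
      openConn o y ∩ openConn x y ∩ (openConn y z)ᶜ := by
    ext ω
    simp only [hM, mem_inter_iff, mem_compl_iff, mem_union]
    constructor
    · rintro ⟨⟨-, hyz'⟩, hJ, hxy'⟩
      refine ⟨⟨?_, hxy'⟩, hyz'⟩
      rcases hJ with hox | hoy
      · exact conn_trans hox hxy'
      · exact hoy
    · rintro ⟨⟨hoy, hxy'⟩, hyz'⟩
      exact ⟨⟨fun hxz' => hyz' (conn_trans (conn_symm hxy') hxz'), hyz'⟩, Or.inr hoy, hxy'⟩
  have s3 : M \ openConn x y = N := by
    ext ω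
    simp only [hM, hN, mem_sdiff, mem_inter_iff, mem_compl_iff]
    tauto
  have s4 : (M ∩ (openConn o x ∪ openConn o y)) \ openConn x y =
      (openConn o x ∩ N) ∪ (openConn o y ∩ N) := by
    ext ω
    simp only [hM, hN, mem_sdiff, mem_inter_iff, mem_compl_iff, mem_union]
    tauto
  have s5 : Disjoint (openConn o x ∩ N) (openConn o y ∩ N) := by
    rw [Set.disjoint_left]
    rintro ω ⟨hox, ⟨⟨hxy', -⟩, -⟩⟩ ⟨hoy, -⟩
    exact hxy' (conn_trans (conn_symm hox) hoy)
  -- `{o↔y} ∩ M = ({o↔y} ∩ {x↔y} ∩ D) ⊔ ({o↔y} ∩ N)`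
  have s9 : (openConn o y ∩ M) ∩ openConn x y = openConn o y ∩ openConn x y ∩ (openConn y z)ᶜ := by
    ext ω
    simp only [hM, mem_inter_iff, mem_compl_iff]
    constructor
    · rintro ⟨⟨hoy, -, hyz'⟩, hxy'⟩
      exact ⟨⟨hoy, hxy'⟩, hyz'⟩
    · rintro ⟨⟨hoy, hxy'⟩, hyz'⟩
      exact ⟨⟨hoy, fun hxz' => hyz' (conn_trans (conn_symm hxy') hxz'), hyz'⟩, hxy'⟩
  have s10 : (openConn o y ∩ M) \ openConn x y = openConn o y ∩ N := by
    ext ω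
    simp only [hM, hN, mem_sdiff, mem_inter_iff, mem_compl_iff]
    tauto
  -- set identities around `D″`
  have s6 : (openConn o y ∩ D2) ∩ openConn x z = D2 ∩ (openConn o y ∩ openConn x z) := by
    ext ω
    simp only [mem_inter_iff]
    tauto
  have s7 : (openConn o y ∩ D2) \ openConn x z = openConn o y ∩ N := by
    ext ω
    simp only [hD2, hN, mem_sdiff, mem_inter_iff, mem_compl_iff, knThm2_openConn_comm y x]
    tauto
  have s8 : D2 \ openConn x z = N := by
    ext ω
    simp only [hD2, hN, mem_sdiff, mem_inter_iff, mem_compl_iff, knThm2_openConn_comm y x]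
    tauto
  have s11 : D2 ∩ openConn x z = Mp := by
    ext ω
    simp only [hD2, hMp, mem_inter_iff, mem_compl_iff, knThm2_openConn_comm y x]
    constructor
    · rintro ⟨⟨-, hyz'⟩, hxz'⟩
      exact ⟨hxz', hyz'⟩
    · rintro ⟨hxz', hyz'⟩
      exact ⟨⟨fun hxy' => hyz' (conn_trans (conn_symm hxy') hxz'), hyz'⟩, hxz'⟩
  have s12 : D2 ∩ (openConn o y ∩ openConn x z) = openConn o y ∩ Mp := by
    ext ω
    simp only [hD2, hMp, mem_inter_iff, mem_compl_iff, knThm2_openConn_comm y x]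
    constructor
    · rintro ⟨⟨-, hyz'⟩, hoy, hxz'⟩
      exact ⟨hoy, hxz', hyz'⟩
    · rintro ⟨hoy, hxz', hyz'⟩
      exact ⟨⟨fun hxy' => hyz' (conn_trans (conn_symm hxy') hxz'), hyz'⟩, hoy, hxz'⟩
  -- measure bookkeeping
  have m1 : μ.real M = μ.real (openConn x y ∩ (openConn y z)ᶜ) + μ.real N := by
    have h := measureReal_inter_add_sdiff (μ := μ) (s := M) (hmeas (openConn x y))
    rw [s1, s3] at h
    linarith
  have m2 : μ.real (M ∩ (openConn o x ∪ openConn o y)) =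
      μ.real (openConn o y ∩ openConn x y ∩ (openConn y z)ᶜ) +
        (μ.real (openConn o x ∩ N) + μ.real (openConn o y ∩ N)) := by
    have h := measureReal_inter_add_sdiff (μ := μ) (s := M ∩ (openConn o x ∪ openConn o y))
      (hmeas (openConn x y))
    rw [inter_assoc, s2, s4, measureReal_union s5 (hmeas _)] at h
    linarith
  have m3 : μ.real (openConn o y ∩ M) =
      μ.real (openConn o y ∩ openConn x y ∩ (openConn y z)ᶜ) + μ.real (openConn o y ∩ N) := by
    have h := measureReal_inter_add_sdiff (μ := μ) (s := openConn o y ∩ M) (hmeas (openConn x y))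
    rw [s9, s10] at h
    linarith
  rw [inter_comm D2 (openConn o y)] at hB
  have m4 : μ.real (openConn o y ∩ D2) = μ.real (openConn o y ∩ Mp) + μ.real (openConn o y ∩ N) := by
    have h := measureReal_inter_add_sdiff (μ := μ) (s := openConn o y ∩ D2) (hmeas (openConn x z))
    rw [s6, s12, s7] at h
    linarith
  have m5 : μ.real D2 = μ.real Mp + μ.real N := by
    have h := measureReal_inter_add_sdiff (μ := μ) (s := D2) (hmeas (openConn x z))
    rw [s11, s8] at h
    linarith
  rw [m2, s1, s2, m1] at hH
  rw [s12, s11, m4, m5] at hB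
  -- abbreviations
  set q := μ.real (openConn x y ∩ (openConn y z)ᶜ) with hq
  set qo := μ.real (openConn o y ∩ openConn x y ∩ (openConn y z)ᶜ) with hqo
  set nN := μ.real N with hnN
  set a := μ.real (openConn o x ∩ N) with ha
  set c := μ.real (openConn o y ∩ N) with hc
  set m' := μ.real Mp with hm'
  set m'o := μ.real (openConn o y ∩ Mp) with hm'o
  -- Harris core: `nN·qo ≥ (a + c)·q`; tilt: `c·m' ≥ nN·m'o`
  have hcore : (a + c) * q ≤ nN * qo := by nlinarith [hH]
  have htilt : nN * m'o ≤ c * m' := by nlinarith [hB]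
  have hq0 : 0 ≤ q := measureReal_nonneg
  have hnN0 : 0 ≤ nN := measureReal_nonneg
  have hm'0 : 0 ≤ m' := measureReal_nonneg
  rw [m3, m1]
  nlinarith [mul_le_mul_of_nonneg_left hcore hm'0, mul_le_mul_of_nonneg_left htilt (add_nonneg hq0 hnN0)]

/-! ### §2. The coincidence case `b = x` of `stub_s2M` -/

/-- **`stub_s2M` for `b = x`.**  With `b = x` the decreasing test event `{z ↮ b} ∩ {y↮z}` is `M = {x↮z} ∩ {y↮z}`, and the
registered inequality `μ({o↔x} ∩ N)·τ_x({x↔y}) ≤ μ(N)·τ_x({o↔y})` is the cross-term inequality `s2Mp_cross`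
(after `μ(D) = μ(M) + μ(M′)`, `μ({o↔y} ∩ D) = μ({o↔y} ∩ M) + μ({o↔y} ∩ M′)`).
[cite: KozmaNitzan2024, Question 7 (p. 36)] -/
theorem s2Mp_case_bx (w : Sym2 (Fin n) → unitInterval) (o x y z : Fin n) (hxy : x ≠ y) (hxz : x ≠ z) (hyz : y ≠ z) :
    (prodBernoulli w).real (openConn o x ∩ ((openConn x y)ᶜ ∩ (openConn x z)ᶜ ∩ (openConn y z)ᶜ)) *
        ((prodBernoulli w).real (openConn y z)ᶜ *
            (prodBernoulli w).real (openConn x y ∩ (openConn z x)ᶜ ∩ (openConn y z)ᶜ) -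
          (prodBernoulli w).real (openConn x y ∩ (openConn y z)ᶜ) *
            (prodBernoulli w).real ((openConn z x)ᶜ ∩ (openConn y z)ᶜ)) ≤
      (prodBernoulli w).real ((openConn x y)ᶜ ∩ (openConn x z)ᶜ ∩ (openConn y z)ᶜ) *
        ((prodBernoulli w).real (openConn y z)ᶜ *
            (prodBernoulli w).real (openConn o y ∩ (openConn z x)ᶜ ∩ (openConn y z)ᶜ) -
          (prodBernoulli w).real (openConn o y ∩ (openConn y z)ᶜ) *
            (prodBernoulli w).real ((openConn z x)ᶜ ∩ (openConn y z)ᶜ)) := by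
  have key := s2Mp_cross w o x y z hxy hxz hyz
  set μ := prodBernoulli w with hμ
  have hmeas : ∀ s : Set (BondConfig (Fin n)), MeasurableSet s := fun _ => MeasurableSet.of_discrete
  rw [knThm2_openConn_comm z x]
  -- set identities
  have e1 : (openConn x y ∩ (openConn x z)ᶜ ∩ (openConn y z)ᶜ : Set (BondConfig (Fin n))) =
      openConn x y ∩ (openConn y z)ᶜ := by
    ext ω
    simp only [mem_inter_iff, mem_compl_iff]
    constructor
    · rintro ⟨⟨hxy', -⟩, hyz'⟩
      exact ⟨hxy', hyz'⟩
    · rintro ⟨hxy', hyz'⟩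
      exact ⟨⟨hxy', fun hxz' => hyz' (conn_trans (conn_symm hxy') hxz')⟩, hyz'⟩
  have e3 : (openConn o y ∩ (openConn x z)ᶜ ∩ (openConn y z)ᶜ : Set (BondConfig (Fin n))) =
      openConn o y ∩ ((openConn x z)ᶜ ∩ (openConn y z)ᶜ) := inter_assoc _ _ _
  have d1 : ((openConn y z)ᶜ : Set (BondConfig (Fin n))) ∩ openConn x z = openConn x z ∩ (openConn y z)ᶜ :=
    inter_comm _ _
  have d2 : ((openConn y z)ᶜ : Set (BondConfig (Fin n))) \ openConn x z = (openConn x z)ᶜ ∩ (openConn y z)ᶜ := by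
    ext ω; simp only [mem_sdiff, mem_compl_iff, mem_inter_iff]; tauto
  have d3 : (openConn o y ∩ (openConn y z)ᶜ : Set (BondConfig (Fin n))) ∩ openConn x z =
      openConn o y ∩ (openConn x z ∩ (openConn y z)ᶜ) := by
    ext ω; simp only [mem_inter_iff, mem_compl_iff]; tauto
  have d4 : (openConn o y ∩ (openConn y z)ᶜ : Set (BondConfig (Fin n))) \ openConn x z =
      openConn o y ∩ ((openConn x z)ᶜ ∩ (openConn y z)ᶜ) := by
    ext ω; simp only [mem_sdiff, mem_inter_iff, mem_compl_iff]; tauto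
  have m6 : μ.real ((openConn y z)ᶜ : Set (BondConfig (Fin n))) =
      μ.real (openConn x z ∩ (openConn y z)ᶜ : Set (BondConfig (Fin n))) +
        μ.real ((openConn x z)ᶜ ∩ (openConn y z)ᶜ : Set (BondConfig (Fin n))) := by
    have h := measureReal_inter_add_sdiff (μ := μ) (s := ((openConn y z)ᶜ : Set (BondConfig (Fin n))))
      (hmeas (openConn x z))
    rw [d1, d2] at h
    linarith
  have m7 : μ.real (openConn o y ∩ (openConn y z)ᶜ : Set (BondConfig (Fin n))) =
      μ.real (openConn o y ∩ (openConn x z ∩ (openConn y z)ᶜ) : Set (BondConfig (Fin n))) +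
        μ.real (openConn o y ∩ ((openConn x z)ᶜ ∩ (openConn y z)ᶜ) : Set (BondConfig (Fin n))) := by
    have h := measureReal_inter_add_sdiff (μ := μ) (s := (openConn o y ∩ (openConn y z)ᶜ : Set (BondConfig (Fin n))))
      (hmeas (openConn x z))
    rw [d3, d4] at h
    linarith
  rw [e1, e3, m6, m7]
  linear_combination key

/-! ### §3. T1 at the sharp constant and the coincidence case `b = o` -/

/-- **T1 at `θ_M`**: `μ({o↔x} ∩ N)·μ({x↔y} ∩ D) ≤ μ(N)·μ({o↔y} ∩ D)`, i.e. `P_D(o↔y) ≥ θ_M·P_D(x↔y)`.  From U1-M (`u1M`):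
`μ(D″) × (claim) ≥ μ(N)·μ({o↔y} ∩ D″)·(μ(D″) + μ({x↔y} ∩ D)) ≥ 0`, and `μ(D″) = 0` forces `μ(N) = μ({o↔x} ∩ N) = 0`.
[cite: KozmaNitzan2024, Lemma 2 (p. 6)] -/
theorem s2Mp_t1M (w : Sym2 (Fin n) → unitInterval) (o x y z : Fin n) (hxy : x ≠ y) (hxz : x ≠ z) (hyz : y ≠ z) :
    (prodBernoulli w).real (openConn o x ∩ ((openConn x y)ᶜ ∩ (openConn x z)ᶜ ∩ (openConn y z)ᶜ)) *
        (prodBernoulli w).real (openConn x y ∩ (openConn y z)ᶜ) ≤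
      (prodBernoulli w).real ((openConn x y)ᶜ ∩ (openConn x z)ᶜ ∩ (openConn y z)ᶜ) *
        (prodBernoulli w).real (openConn o y ∩ (openConn y z)ᶜ) := by
  have hU := u1M w o x y z hxy hxz hyz
  set μ := prodBernoulli w with hμ
  have hmeas : ∀ s : Set (BondConfig (Fin n)), MeasurableSet s := fun _ => MeasurableSet.of_discrete
  -- `μ({o↔y} ∩ D) = μ({o↔y} ∩ {x↔y} ∩ D) + μ({o↔y} ∩ D″)`
  have d1 : (openConn o y ∩ (openConn y z)ᶜ : Set (BondConfig (Fin n))) ∩ openConn x y =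
      openConn o y ∩ openConn x y ∩ (openConn y z)ᶜ := by
    ext ω; simp only [mem_inter_iff, mem_compl_iff]; tauto
  have d2 : (openConn o y ∩ (openConn y z)ᶜ : Set (BondConfig (Fin n))) \ openConn x y =
      openConn o y ∩ ((openConn y x)ᶜ ∩ (openConn y z)ᶜ) := by
    ext ω; simp only [mem_sdiff, mem_inter_iff, mem_compl_iff, knThm2_openConn_comm y x]; tauto
  have m1 : μ.real (openConn o y ∩ (openConn y z)ᶜ : Set (BondConfig (Fin n))) =
      μ.real (openConn o y ∩ openConn x y ∩ (openConn y z)ᶜ : Set (BondConfig (Fin n))) +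
        μ.real (openConn o y ∩ ((openConn y x)ᶜ ∩ (openConn y z)ᶜ) : Set (BondConfig (Fin n))) := by
    have h := measureReal_inter_add_sdiff (μ := μ) (s := (openConn o y ∩ (openConn y z)ᶜ : Set (BondConfig (Fin n))))
      (hmeas (openConn x y))
    rw [d1, d2] at h
    linarith
  -- `N ⊆ D″`, `{o↔x} ∩ N ⊆ N`
  have hsub : ((openConn x y)ᶜ ∩ (openConn x z)ᶜ ∩ (openConn y z)ᶜ : Set (BondConfig (Fin n))) ⊆
      (openConn y x)ᶜ ∩ (openConn y z)ᶜ := by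
    rintro ω ⟨⟨hxy', -⟩, hyz'⟩
    exact ⟨fun h => hxy' (conn_symm h), hyz'⟩
  have hNle : μ.real ((openConn x y)ᶜ ∩ (openConn x z)ᶜ ∩ (openConn y z)ᶜ : Set (BondConfig (Fin n))) ≤
      μ.real ((openConn y x)ᶜ ∩ (openConn y z)ᶜ : Set (BondConfig (Fin n))) := measureReal_mono hsub
  have hale : μ.real (openConn o x ∩ ((openConn x y)ᶜ ∩ (openConn x z)ᶜ ∩ (openConn y z)ᶜ) : Set (BondConfig (Fin n))) ≤
      μ.real ((openConn x y)ᶜ ∩ (openConn x z)ᶜ ∩ (openConn y z)ᶜ : Set (BondConfig (Fin n))) :=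
    measureReal_mono inter_subset_right
  set t := μ.real ((openConn y x)ᶜ ∩ (openConn y z)ᶜ : Set (BondConfig (Fin n))) with ht
  set tO := μ.real (openConn o y ∩ ((openConn y x)ᶜ ∩ (openConn y z)ᶜ) : Set (BondConfig (Fin n))) with htO
  set q := μ.real (openConn x y ∩ (openConn y z)ᶜ : Set (BondConfig (Fin n))) with hq
  set qo := μ.real (openConn o y ∩ openConn x y ∩ (openConn y z)ᶜ : Set (BondConfig (Fin n))) with hqo
  set nN := μ.real ((openConn x y)ᶜ ∩ (openConn x z)ᶜ ∩ (openConn y z)ᶜ : Set (BondConfig (Fin n))) with hnN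
  set a := μ.real (openConn o x ∩ ((openConn x y)ᶜ ∩ (openConn x z)ᶜ ∩ (openConn y z)ᶜ) : Set (BondConfig (Fin n))) with ha
  have ht0 : 0 ≤ t := measureReal_nonneg
  have htO0 : 0 ≤ tO := measureReal_nonneg
  have hq0 : 0 ≤ q := measureReal_nonneg
  have hnN0 : 0 ≤ nN := measureReal_nonneg
  have ha0 : 0 ≤ a := measureReal_nonneg
  rw [m1]
  have key : t * (a * q) ≤ t * (nN * (qo + tO)) := by nlinarith [hU, mul_nonneg (mul_nonneg hnN0 htO0) (add_nonneg ht0 hq0)]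
  by_cases htz : t = 0
  · have hN0 : nN = 0 := le_antisymm (by simpa [htz] using hNle) hnN0
    have ha_z : a = 0 := le_antisymm (by simpa [hN0] using hale) ha0
    rw [ha_z, hN0]; simp
  · exact le_of_mul_le_mul_left key (lt_of_le_of_ne ht0 (Ne.symm htz))

/-- **`stub_s2M` for `b = o`.**  With `b = o`: `{o↔y} ∩ {z↔o} ∩ D = ∅` (it would join `y` to `z`), so
`μ({o↔x} ∩ N)·τ_o({x↔y}) ≤ μ(N)·τ_o({o↔y})` reads
`μ({o↔x} ∩ N)·[μ({x↔y} ∩ D)μ({z↔o} ∩ D) − μ(D)μ({x↔y} ∩ {z↔o} ∩ D)] ≤ μ(N)·μ({o↔y} ∩ D)·μ({z↔o} ∩ D)`,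
which is `μ({z↔o} ∩ D) ×` T1 at `θ_M` (`s2Mp_t1M`) plus a nonnegative term.
[cite: KozmaNitzan2024, Question 7 (p. 36)] -/
theorem s2Mp_case_bo (w : Sym2 (Fin n) → unitInterval) (o x y z : Fin n) (hxy : x ≠ y) (hxz : x ≠ z) (hyz : y ≠ z) :
    (prodBernoulli w).real (openConn o x ∩ ((openConn x y)ᶜ ∩ (openConn x z)ᶜ ∩ (openConn y z)ᶜ)) *
        ((prodBernoulli w).real (openConn y z)ᶜ *
            (prodBernoulli w).real (openConn x y ∩ (openConn z o)ᶜ ∩ (openConn y z)ᶜ) -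
          (prodBernoulli w).real (openConn x y ∩ (openConn y z)ᶜ) *
            (prodBernoulli w).real ((openConn z o)ᶜ ∩ (openConn y z)ᶜ)) ≤
      (prodBernoulli w).real ((openConn x y)ᶜ ∩ (openConn x z)ᶜ ∩ (openConn y z)ᶜ) *
        ((prodBernoulli w).real (openConn y z)ᶜ *
            (prodBernoulli w).real (openConn o y ∩ (openConn z o)ᶜ ∩ (openConn y z)ᶜ) -
          (prodBernoulli w).real (openConn o y ∩ (openConn y z)ᶜ) *
            (prodBernoulli w).real ((openConn z o)ᶜ ∩ (openConn y z)ᶜ)) := by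
  have hT := s2Mp_t1M w o x y z hxy hxz hyz
  set μ := prodBernoulli w with hμ
  have hmeas : ∀ s : Set (BondConfig (Fin n)), MeasurableSet s := fun _ => MeasurableSet.of_discrete
  -- complements inside `D`
  have d1 : ((openConn y z)ᶜ : Set (BondConfig (Fin n))) \ openConn z o = (openConn z o)ᶜ ∩ (openConn y z)ᶜ := by
    ext ω; simp only [mem_sdiff, mem_compl_iff, mem_inter_iff]; tauto
  have m1 : μ.real ((openConn y z)ᶜ ∩ openConn z o : Set (BondConfig (Fin n))) +
      μ.real ((openConn z o)ᶜ ∩ (openConn y z)ᶜ : Set (BondConfig (Fin n))) =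
        μ.real ((openConn y z)ᶜ : Set (BondConfig (Fin n))) := by
    have h := measureReal_inter_add_sdiff (μ := μ) (s := ((openConn y z)ᶜ : Set (BondConfig (Fin n))))
      (t := openConn z o) (hmeas _)
    rw [d1] at h; exact h
  have d2 : (openConn x y ∩ (openConn y z)ᶜ : Set (BondConfig (Fin n))) \ openConn z o =
      openConn x y ∩ (openConn z o)ᶜ ∩ (openConn y z)ᶜ := by
    ext ω; simp only [mem_sdiff, mem_inter_iff, mem_compl_iff]; tauto
  have m2 : μ.real ((openConn x y ∩ (openConn y z)ᶜ) ∩ openConn z o : Set (BondConfig (Fin n))) +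
      μ.real (openConn x y ∩ (openConn z o)ᶜ ∩ (openConn y z)ᶜ : Set (BondConfig (Fin n))) =
        μ.real (openConn x y ∩ (openConn y z)ᶜ : Set (BondConfig (Fin n))) := by
    have h := measureReal_inter_add_sdiff (μ := μ) (s := (openConn x y ∩ (openConn y z)ᶜ : Set (BondConfig (Fin n))))
      (t := openConn z o) (hmeas _)
    rw [d2] at h; exact h
  -- `{o↔y} ∩ {z↔o} ∩ D = ∅`
  have d3 : (openConn o y ∩ (openConn z o)ᶜ ∩ (openConn y z)ᶜ : Set (BondConfig (Fin n))) =
      openConn o y ∩ (openConn y z)ᶜ := by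
    ext ω
    simp only [mem_inter_iff, mem_compl_iff]
    constructor
    · rintro ⟨⟨hoy, -⟩, hyz'⟩
      exact ⟨hoy, hyz'⟩
    · rintro ⟨hoy, hyz'⟩
      exact ⟨⟨hoy, fun hzo => hyz' (conn_symm (conn_trans hzo hoy))⟩, hyz'⟩
  rw [d3]
  set d := μ.real ((openConn y z)ᶜ : Set (BondConfig (Fin n))) with hd
  set dz := μ.real ((openConn y z)ᶜ ∩ openConn z o : Set (BondConfig (Fin n))) with hdz
  set q := μ.real (openConn x y ∩ (openConn y z)ᶜ : Set (BondConfig (Fin n))) with hq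
  set qz := μ.real ((openConn x y ∩ (openConn y z)ᶜ) ∩ openConn z o : Set (BondConfig (Fin n))) with hqz
  set nN := μ.real ((openConn x y)ᶜ ∩ (openConn x z)ᶜ ∩ (openConn y z)ᶜ : Set (BondConfig (Fin n))) with hnN
  set a := μ.real (openConn o x ∩ ((openConn x y)ᶜ ∩ (openConn x z)ᶜ ∩ (openConn y z)ᶜ) : Set (BondConfig (Fin n))) with ha
  set oyD := μ.real (openConn o y ∩ (openConn y z)ᶜ : Set (BondConfig (Fin n))) with hoyD
  have hd0 : 0 ≤ d := measureReal_nonneg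
  have hdz0 : 0 ≤ dz := measureReal_nonneg
  have hqz0 : 0 ≤ qz := measureReal_nonneg
  have ha0 : 0 ≤ a := measureReal_nonneg
  have e1 : μ.real ((openConn z o)ᶜ ∩ (openConn y z)ᶜ : Set (BondConfig (Fin n))) = d - dz := by linarith
  have e2 : μ.real (openConn x y ∩ (openConn z o)ᶜ ∩ (openConn y z)ᶜ : Set (BondConfig (Fin n))) = q - qz := by linarith
  rw [e1, e2]
  nlinarith [mul_le_mul_of_nonneg_right hT hdz0, mul_nonneg (mul_nonneg ha0 hd0) hqz0]

end

end Summit.CriticalPhenomena.PercolationContinuityZ3.Theorems
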